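import Literature.Probability.LatticeModels.IsingThermodynamics
import Literature.Probability.LatticeModels.ScalingLimit
import HarnessLib

/-!
# The nearest-neighbour Ising model on `ℤ^d` with axis-dependent couplings

Topic `Probability/LatticeModels` (definition item `defn-anisoPlusExpect`, route
`CriticalPhenomena/PlanarCornerRotations`, card rotations-from-planar-corner: the layered corner
`(J, J, εJ)` of the critical surface of `ℤ³`; also cards flux-quadrupole-stress-tensor and
log-polar-proxy-exact-inversion).

The **anisotropic** nearest-neighbour Ising model on `ℤ^d` with ferromagnetic couplings
`J = (J₀, …, J_{d-1})`, one per coordinate axis: finite-volume Hamiltonian with boundary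
condition `bc` (free or fixed) and magnetic field `h`,

`H_{Λ;J,h}^{bc}(σ) = -∑_{{x,y} ∈ ℰ_Λ^{bc}} J_{i(x,y)} σ_x σ_y - h ∑_{x ∈ Λ} σ_x`,

where `i(x, y)` is the axis of the lattice edge `{x, y} = {x, x + e_i}`: the case
`J_{xy} = J_{i(x,y)}` of the Ising Hamiltonian with edge-dependent couplings
`ℋ_{Λ;J,h} = -∑_{{i,j} ∈ ℰ_Λ^b} J_{ij} σ_i σ_j - ∑ h_i σ_i` of Friedli–Velenik 2017, §3.6.2,
eq. (3.20) (there with `β` absorbed in `J`; here `β` is kept as the tilt parameter, so the Gibbs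
measure below is their `μ^η_{Λ;βJ,βh}`), i.e. "lattice anisotropy" (Liu–Stanley 1972: layers
`(J, J, εJ)`; McCoy–Wu 1973: the square lattice with horizontal/vertical energies `E₁, E₂`). The
finite-volume Gibbs formalism of `IsingModel` (Friedli–Velenik 2017, §3.1) is reused verbatim.
Everything is the isotropic construction of `IsingModel` / `IsingThermodynamics` with the bond
term weighted by the **axis coupling** of the bond:

* `axisCoupling J e` — `J_i` for a lattice edge `e = {x, x + e_i}` (`axisCoupling_single`); in
  general the sum of `J_i` over the coordinates in which the two endpoints differ (junk off the
  edge set, never summed).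
* `anisoHamiltonian J Λ h bc`, `anisoMeasure J Λ β h bc` (the reference measure `isingRef Λ bc`
  tilted by `exp (-β H)`, a probability measure), `anisoExpect J Λ β h bc f = ∫ f dμ`.
* `anisoPlusExpect d J β h f = lim_{L → ∞} ⟨f⟩^+_{B(L);J,β,h}` — the plus state as a limit
  functional along boxes, by `limUnder`, **junk-valued when divergent** (exactly the shape of
  `plusExpect`; for `J ≥ 0`, `β ≥ 0`, `h ≥ 0` and local `f` the limit exists by GKS as in the
  isotropic case, Friedli–Velenik 2017, Thm. 3.17 — not proved here).
* `anisoCorr d J β : LatticeCorrFamily d` — the plus-state `n`-point functions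
  `⟨σ_{x₁} ⋯ σ_{xₙ}⟩⁺_{J,β,0}` (shape of `criticalCorr`).
* `anisoCriticalBeta d J = inf {β ≥ 0 | ⟨σ₀⟩⁺_{J,β,0} > 0}` (as requested; for the isotropic
  model this agrees with `criticalBeta d = inf {β ≥ 0 | m*(β) > 0}` through the identity
  `⟨σ₀⟩⁺_{β,0} = m*(β)`, the named fact `plusExpect_spinAt_eq_spontaneousMagnetization`).

## Sanity (proved): unit couplings recover the isotropic model

`axisCoupling_const_of_mem_edgeSet` (`axisCoupling (fun _ => c) e = c` on lattice edges),
`anisoHamiltonian_one = isingHamiltonian (zdGraph d)`, `anisoMeasure_one`, `anisoExpect_one`,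
`anisoPlusExpect_one : anisoPlusExpect d (fun _ => 1) = plusExpect d`,
`anisoCorr_one_criticalBeta : anisoCorr d (fun _ => 1) (criticalBeta d) = criticalCorr d`.

## References

* [FriedliVelenik2017] S. Friedli, Y. Velenik, *Statistical Mechanics of Lattice Systems* (CUP
  2017), §3.6.2 eq. (3.20) (edge-dependent couplings `J_{ij}`, Gibbs distribution
  `μ^η_{Λ;J,h}`), §3.1 (eqs. (3.2), (3.6)–(3.8)), §3.4 Thm. 3.17 (plus state), Def. 3.29
  (`β_c`). Held (`book:friedli2017-…`), read.
* [LiuStanley1972] L. L. Liu, H. E. Stanley, *Some rigorous results concerning the crossover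
  behavior of the Ising model with lattice anisotropy*, Phys. Lett. A 40 (1972) 272–274 —
  couplings `(J, J, εJ)` = `axisCoupling ![J, J, ε * J]`. Not held.
* [MccoyWu1973] B. M. McCoy, T. T. Wu, *The Two-Dimensional Ising Model* (Harvard UP, 1973) —
  the square lattice with unequal horizontal/vertical interaction energies. Not held.

## Design notes

* Same universe/measurability conventions as `IsingModel`: `SpinConfig (Site d) = Site d → ℤˣ`
  with the product σ-algebra; probabilities/expectations are Bochner integrals.
* `d` is explicit in the infinite-volume objects (`anisoPlusExpect d J …`) as for `plusExpect d`;
  implicit in the finite-volume ones (recovered from `Λ : Finset (Site d)`).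
* No named facts (D-0026): existence of the box limits, GKS, `β_c(J) > 0` are not asserted.
-/

noncomputable section

open MeasureTheory Filter Topology Finset

namespace Literature.Probability.LatticeModels

variable {d : ℕ}

/-! ### Axis couplings -/

/-- The **axis coupling** of an unordered pair of sites for the coupling vector
`J : Fin d → ℝ`: the sum of `J_i` over the coordinates `i` in which the two sites differ. For a
lattice edge `{x, x + e_i}` of `ℤ^d` this is `J_i`, the coupling of the bonds parallel to the
`i`-th axis (the edge couplings `J_{ij}` of Friedli–Velenik 2017, eq. (3.20), for lattice
anisotropy: Liu–Stanley 1972; McCoy–Wu 1973 for `d = 2`); off the edge set the value is junk and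
is never used (Hamiltonians only sum over lattice edges). Defined through `Sym2.lift`. [folklore] -/
def axisCoupling (J : Fin d → ℝ) : Sym2 (Site d) → ℝ :=
  Sym2.lift ⟨fun x y => ∑ i, if x i = y i then 0 else J i, fun x y => by
    simp only [eq_comm]⟩

/-- `axisCoupling J s(x, y) = ∑_i [x_i ≠ y_i] J_i`. [folklore] -/
@[simp] theorem axisCoupling_mk (J : Fin d → ℝ) (x y : Site d) :
    axisCoupling J s(x, y) = ∑ i, if x i = y i then 0 else J i := rfl

/-- On the lattice edge `{x, x + e_i}` the axis coupling is `J_i`. [folklore] -/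
theorem axisCoupling_single (J : Fin d → ℝ) (x : Site d) (i : Fin d) :
    axisCoupling J s(x, x + Pi.single i 1) = J i := by
  rw [axisCoupling_mk, Finset.sum_eq_single i]
  · simp
  · intro j _ hj
    have : (x + Pi.single i 1 : Site d) j = x j := by simp [hj]
    simp [this]
  · simp

/-- On every edge of `ℤ^d` the axis coupling of a **constant** coupling vector `(c, …, c)` is
`c` (the two endpoints differ in exactly one coordinate). [folklore] -/
theorem axisCoupling_const_of_mem_edgeSet (c : ℝ) {e : Sym2 (Site d)}
    (he : e ∈ (zdGraph d).edgeSet) : axisCoupling (fun _ => c) e = c := by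
  induction e using Sym2.ind with
  | _ x y =>
    rw [SimpleGraph.mem_edgeSet] at he
    obtain ⟨i, h | h⟩ := (zdGraph_adj_iff x y).1 he
    · subst h; exact axisCoupling_single (fun _ => c) x i
    · subst h; rw [Sym2.eq_swap]; exact axisCoupling_single (fun _ => c) y i

/-! ### Finite volume: Hamiltonian, Gibbs measure, expectations -/

/-- The finite-volume **anisotropic Ising Hamiltonian** with boundary condition `bc`,
`H_{Λ;J,h}^{bc}(σ) = -∑_{{x,y} ∈ ℰ^{bc}_Λ} J_{i(x,y)} σ_x σ_y - h ∑_{x ∈ Λ} σ_x`: the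
Hamiltonian with edge-dependent couplings of Friedli–Velenik 2017, §3.6.2, eq. (3.20)
(`ℋ_{Λ;J,h} = -∑_{{i,j} ∈ ℰ_Λ^b} J_{ij} σ_i σ_j - ∑ h_i σ_i`) at `J_{xy} = J_{i(x,y)}`, `h_x = h`,
in the boundary-condition bookkeeping of `isingHamiltonian` (§3.1, eqs. (3.2), (3.6)); FV absorb
`β` in `J`, here `β` multiplies `H` in the Gibbs weight.
[cite: FriedliVelenik2017, §3.6.2 eq. (3.20)] -/
def anisoHamiltonian (J : Fin d → ℝ) (Λ : Finset (Site d)) (h : ℝ) (bc : BoundaryCondition (Site d))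
    (σ : SpinConfig (Site d)) : ℝ :=
  -(∑ e ∈ interactionEdges (zdGraph d) Λ bc, axisCoupling J e * bondSpin σ e) -
    h * ∑ x ∈ Λ, spinAt x σ

/-- The anisotropic Hamiltonian is measurable for the product σ-algebra (as
`measurable_isingHamiltonian`, Friedli–Velenik 2017, §6.2). [cite: FriedliVelenik2017, §6.2] -/
@[fun_prop]
theorem measurable_anisoHamiltonian (J : Fin d → ℝ) (Λ : Finset (Site d)) (h : ℝ)
    (bc : BoundaryCondition (Site d)) : Measurable (anisoHamiltonian J Λ h bc) := by
  unfold anisoHamiltonian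
  refine Measurable.sub (Finset.measurable_sum _ fun e _ => ?_).neg ?_
  · exact (measurable_bondSpin e).const_mul _
  · exact (Finset.measurable_sum _ fun x _ => measurable_spinAt x).const_mul h

/-- Interaction edges are lattice edges (both boundary conditions); a private copy of
`mem_edgeSet_of_mem_interactionEdges` of `GKSInequalities` (not imported here).
[cite: FriedliVelenik2017, §3.1] -/
private theorem mem_edgeSet_of_mem_interactionEdges' {Λ : Finset (Site d)} {bc : BoundaryCondition (Site d)}
    {e : Sym2 (Site d)} (he : e ∈ interactionEdges (zdGraph d) Λ bc) : e ∈ (zdGraph d).edgeSet := by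
  cases bc with
  | free => exact (mem_edgesIn_iff.1 (by simpa using he)).1
  | fixed η => exact (mem_edgesTouching_iff.1 (by simpa using he)).1

/-- **Unit couplings recover the isotropic Hamiltonian**:
`anisoHamiltonian (1, …, 1) = isingHamiltonian (zdGraph d)` (Friedli–Velenik 2017, eq. (3.2)).
[cite: FriedliVelenik2017, §3.1 eq. (3.2)] -/
theorem anisoHamiltonian_one (Λ : Finset (Site d)) (h : ℝ) (bc : BoundaryCondition (Site d)) :
    anisoHamiltonian (fun _ => (1 : ℝ)) Λ h bc = isingHamiltonian (zdGraph d) Λ h bc := by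
  funext σ
  unfold anisoHamiltonian isingHamiltonian
  congr 2
  refine Finset.sum_congr rfl fun e he => ?_
  rw [axisCoupling_const_of_mem_edgeSet 1 (mem_edgeSet_of_mem_interactionEdges' he), one_mul]

/-- The finite-volume **anisotropic Ising Gibbs measure** `μ_{Λ;J,β,h}^{bc}`: the reference
measure `isingRef Λ bc` (counting measure on `{±1}^Λ` glued with `bc`) tilted by
`exp (-β H_{Λ;J,h}^{bc})` (Mathlib `Measure.tilted`, normalised): the Gibbs distribution
`μ^{bc}_{Λ;βJ,βh}` of Friedli–Velenik 2017, §3.6.2 (after eq. (3.20)), Def. 3.1 / eq. (3.7).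
[cite: FriedliVelenik2017, §3.6.2 eq. (3.20)] -/
def anisoMeasure (J : Fin d → ℝ) (Λ : Finset (Site d)) (β h : ℝ) (bc : BoundaryCondition (Site d)) :
    Measure (SpinConfig (Site d)) :=
  (isingRef Λ bc).tilted fun σ => -β * anisoHamiltonian J Λ h bc σ

/-- The Boltzmann factor is integrable against the finite reference measure
(as `integrable_exp_isingHamiltonian`, Friedli–Velenik 2017, §3.1).
[cite: FriedliVelenik2017, §3.1] -/
theorem integrable_exp_anisoHamiltonian (J : Fin d → ℝ) (Λ : Finset (Site d)) (β h : ℝ)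
    (bc : BoundaryCondition (Site d)) :
    Integrable (fun σ => Real.exp (-β * anisoHamiltonian J Λ h bc σ)) (isingRef Λ bc) := by
  have hm : Measurable fun σ => Real.exp (-β * anisoHamiltonian J Λ h bc σ) :=
    Real.measurable_exp.comp ((measurable_anisoHamiltonian J Λ h bc).const_mul _)
  rw [isingRef, integrable_map_measure hm.aestronglyMeasurable (measurable_glue Λ bc).aemeasurable]
  exact Integrable.of_finite

/-- The finite-volume anisotropic Ising measure is a probability measure
(`isProbabilityMeasure_tilted`; Friedli–Velenik 2017, §3.1). [cite: FriedliVelenik2017, §3.1] -/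
instance anisoMeasure.instIsProbabilityMeasure (J : Fin d → ℝ) (Λ : Finset (Site d)) (β h : ℝ)
    (bc : BoundaryCondition (Site d)) : IsProbabilityMeasure (anisoMeasure J Λ β h bc) :=
  isProbabilityMeasure_tilted (integrable_exp_anisoHamiltonian J Λ β h bc)

/-- Unit couplings recover the isotropic Gibbs measure. [cite: FriedliVelenik2017, §3.1 Def. 3.1] -/
theorem anisoMeasure_one (Λ : Finset (Site d)) (β h : ℝ) (bc : BoundaryCondition (Site d)) :
    anisoMeasure (fun _ => (1 : ℝ)) Λ β h bc = isingMeasure (zdGraph d) Λ β h bc := by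
  rw [anisoMeasure, anisoHamiltonian_one]
  rfl

/-- The Gibbs expectation `⟨f⟩_{Λ;J,β,h}^{bc} = ∫ f dμ_{Λ;J,β,h}^{bc}` (Friedli–Velenik 2017,
§3.1, eq. (3.8), with axis-dependent couplings). [cite: FriedliVelenik2017, §3.1 eq. (3.8)] -/
def anisoExpect (J : Fin d → ℝ) (Λ : Finset (Site d)) (β h : ℝ) (bc : BoundaryCondition (Site d))
    (f : SpinConfig (Site d) → ℝ) : ℝ :=
  ∫ σ, f σ ∂anisoMeasure J Λ β h bc

/-- Unit couplings recover the isotropic expectations `isingExpect (zdGraph d)`.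
[cite: FriedliVelenik2017, §3.1 eq. (3.8)] -/
theorem anisoExpect_one (Λ : Finset (Site d)) (β h : ℝ) (bc : BoundaryCondition (Site d))
    (f : SpinConfig (Site d) → ℝ) :
    anisoExpect (fun _ => (1 : ℝ)) Λ β h bc f = isingExpect (zdGraph d) Λ β h bc f := by
  rw [anisoExpect, anisoMeasure_one]
  rfl

/-! ### Infinite volume: the plus state, correlations, the critical point -/

variable (d)

/-- The **plus state** `⟨f⟩⁺_{J,β,h} = lim_{L → ∞} ⟨f⟩_{B(L);J,β,h}^+` of the anisotropic model,
as a limit functional along the boxes `B(L)`, by `limUnder` — **junk-valued** when the box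
sequence does not converge (it converges for local `f` when `J ≥ 0`, `β ≥ 0`, `h ≥ 0`, by the
GKS argument of Friedli–Velenik 2017, Thm. 3.17; not asserted here). Exactly the shape of
`plusExpect`, which is the case `J = (1, …, 1)` (`anisoPlusExpect_one`).
[cite: FriedliVelenik2017, §3.4 Thm. 3.17] -/
def anisoPlusExpect (J : Fin d → ℝ) (β h : ℝ) (f : SpinConfig (Site d) → ℝ) : ℝ :=
  limUnder atTop fun L : ℕ => anisoExpect J (box d L) β h .plus f

/-- The plus-state `n`-point functions `⟨σ_{x₁} ⋯ σ_{xₙ}⟩⁺_{J,β,0}` of the anisotropic model at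
zero field, as a `LatticeCorrFamily d` (repetitions allowed; the shape of `criticalCorr`)
(Friedli–Velenik 2017, §3.10). [cite: FriedliVelenik2017, §3.10] -/
def anisoCorr (J : Fin d → ℝ) (β : ℝ) : LatticeCorrFamily d :=
  fun _ x => anisoPlusExpect d J β 0 (spinMonomial x)

/-- The **critical inverse temperature** of the anisotropic model,
`β_c(J) = inf {β ≥ 0 | ⟨σ₀⟩⁺_{J,β,0} > 0}` (onset of spontaneous magnetisation in the plus
state; `sInf ∅ = 0` is the junk value when there is no transition, e.g. `d = 1`)
(Friedli–Velenik 2017, Def. 3.29 with §3.4: `⟨σ₀⟩⁺_{β,0} = m*(β)`; Liu–Stanley 1972 for the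
dependence on a weak interlayer coupling). [cite: FriedliVelenik2017, Definition 3.29] -/
def anisoCriticalBeta (J : Fin d → ℝ) : ℝ :=
  sInf {β : ℝ | 0 ≤ β ∧ 0 < anisoPlusExpect d J β 0 (spinAt 0)}

/-- `β_c(J) ≥ 0`. [cite: FriedliVelenik2017, Definition 3.29] -/
theorem anisoCriticalBeta_nonneg (J : Fin d → ℝ) : 0 ≤ anisoCriticalBeta d J :=
  Real.sInf_nonneg fun _ hβ => hβ.1

/-- Unit couplings recover the isotropic plus state: `anisoPlusExpect d (1, …, 1) = plusExpect d`
(Friedli–Velenik 2017, §3.4). [cite: FriedliVelenik2017, §3.4 Thm. 3.17] -/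
theorem anisoPlusExpect_one : anisoPlusExpect d (fun _ => (1 : ℝ)) = plusExpect d := by
  funext β h f
  simp only [anisoPlusExpect, plusExpect, anisoExpect_one]

/-- Unit couplings at `β_c(d)` recover the critical correlators of `IsingThermodynamics`:
`anisoCorr d (1, …, 1) (criticalBeta d) = criticalCorr d`. [cite: FriedliVelenik2017, §3.10] -/
theorem anisoCorr_one_criticalBeta :
    anisoCorr d (fun _ => (1 : ℝ)) (criticalBeta d) = criticalCorr d := by
  funext n x
  simp only [anisoCorr, criticalCorr, anisoPlusExpect_one]

end Literature.Probability.LatticeModels
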